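import Summits.Ventures.Crystal3D.Theorems.StickyWulffConstantGenericWallFloorExitsPay
import Summits.Ventures.Crystal3D.Theorems.StickyWulffConstantNoReconstructionGainGrainGeom
import HarnessLib

/-!
# Restricted exits pay: lane G's `card_exits_le` for any sub-family of exits (co-axial cell bookkeeping)

HONEST FRAMING. Part of the venture `Summits/Ventures/Crystal3D` (cell `crystal3d-full`), helper
`--supports` the crux `CoaxialWallLaw` (stmt-Ventures-19481, `route-Ventures-StickyWulffConstant`),
REGISTERED line `WallLedgerF` (planner cf-p1 gen 16), stub `stub_coaxialTwoSlabAdhesion`.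
Brick of the general-filling port (folder memo): in the co-axial cell the exits that can be charged are a
SUB-FAMILY of lane G's exits (on grain-1 sites, `…CoaxialWallLawExitsOnGrain`; or below height
`h + R₀ + 2`, `…CoaxialWallLawExitsBelow`), so the payers have to be located near THOSE exits only.
`card_exits_le_restrict` is 19480-p1's `card_exits_le` (`…GenericWallFloorExitsPay`) with an arbitrary
restricting predicate `Q` carried through: `#{Q-exits} ≤ #{twin-capped Q-exits} + 1885 · #{unsaturated
balls within contact distance 3 of a Q-exit}` — same proof (`exit_trichotomy` per exit, fibres ≤ 1885).
Inputs BY NAME: `KissingGap δ`, `KissingClassification δ`.  Rung credit only; F-C1 not moved.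
-/

noncomputable section

namespace Summit.Ventures.Crystal3D.Theorems

open Summit.Ventures.Crystal3D Finset
open Literature.MathematicalPhysics.StatisticalMechanics (fccStacking)
open scoped InnerProductSpace

variable {X : Finset (EuclideanSpace ℝ (Fin 3))}

open scoped Classical in
/-- **Restricted exits pay.**  For any predicate `Q` on balls: the `u`-exits satisfying `Q` number at most
the twin-capped ones plus `1885 ×` the unsaturated balls within contact distance three of a `Q`-exit. -/
theorem card_exits_le_restrict {δ : ℝ} (hg : KissingGap δ) (hc : KissingClassification δ)
    (hX : ∀ p ∈ X, ∀ q ∈ X, p ≠ q → 1 ≤ dist p q)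
    (A : EuclideanSpace ℝ (Fin 3) ≃ₗᵢ[ℝ] EuclideanSpace ℝ (Fin 3)) {u : EuclideanSpace ℝ (Fin 3)}
    (hu : u ∈ fccSlots) (Q : EuclideanSpace ℝ (Fin 3) → Prop) :
    (X.filter fun e => Q e ∧ e - A u ∈ X ∧ (∀ w ∈ fccSlots, e - A u + A w ∈ X) ∧
        ∃ v ∈ fccSlots, e + A v ∉ X).card ≤
      ((X.filter fun e => Q e ∧ e - A u ∈ X ∧ (∀ w ∈ fccSlots, e - A u + A w ∈ X) ∧
          ∃ v ∈ fccSlots, e + A v ∉ X).filter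
        fun e => ∃ n : EuclideanSpace ℝ (Fin 3), ‖n‖ = 1 ∧
          (∀ w ∈ fccSlots, ⟪A w, n⟫_ℝ = 0 ∨ ⟪A w, n⟫_ℝ = Real.sqrt (2 / 3) ∨ ⟪A w, n⟫_ℝ = -Real.sqrt (2 / 3)) ∧
          ⟪A u, n⟫_ℝ = Real.sqrt (2 / 3) ∧
          (∀ w ∈ fccSlots, ⟪A w, n⟫_ℝ ≤ 0 → e + A w ∈ X) ∧
          (∀ w ∈ fccSlots, 0 < ⟪A w, n⟫_ℝ → e + A w ∉ X ∧ e - A w + (2 * ⟪A w, n⟫_ℝ) • n ∈ X)).card +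
      1885 * (X.filter fun y => (X.filter fun q => dist y q = 1).card ≠ 12 ∧
        ∃ e ∈ X, (Q e ∧ e - A u ∈ X ∧ (∀ w ∈ fccSlots, e - A u + A w ∈ X) ∧ ∃ v ∈ fccSlots, e + A v ∉ X) ∧
          (y = e ∨ dist e y = 1 ∨ (∃ z ∈ X, dist e z = 1 ∧ dist z y = 1) ∨
            ∃ z ∈ X, ∃ z' ∈ X, dist e z = 1 ∧ dist z z' = 1 ∧ dist z' y = 1)).card := by
  -- names
  set EX := X.filter fun e => Q e ∧ e - A u ∈ X ∧ (∀ w ∈ fccSlots, e - A u + A w ∈ X) ∧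
    ∃ v ∈ fccSlots, e + A v ∉ X with hEX
  set capped : EuclideanSpace ℝ (Fin 3) → Prop := fun e => ∃ n : EuclideanSpace ℝ (Fin 3), ‖n‖ = 1 ∧
    (∀ w ∈ fccSlots, ⟪A w, n⟫_ℝ = 0 ∨ ⟪A w, n⟫_ℝ = Real.sqrt (2 / 3) ∨ ⟪A w, n⟫_ℝ = -Real.sqrt (2 / 3)) ∧
    ⟪A u, n⟫_ℝ = Real.sqrt (2 / 3) ∧
    (∀ w ∈ fccSlots, ⟪A w, n⟫_ℝ ≤ 0 → e + A w ∈ X) ∧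
    (∀ w ∈ fccSlots, 0 < ⟪A w, n⟫_ℝ → e + A w ∉ X ∧ e - A w + (2 * ⟪A w, n⟫_ℝ) • n ∈ X) with hcapped
  set W3 : EuclideanSpace ℝ (Fin 3) → EuclideanSpace ℝ (Fin 3) → Prop := fun e y =>
    y = e ∨ dist e y = 1 ∨ (∃ z ∈ X, dist e z = 1 ∧ dist z y = 1) ∨
      ∃ z ∈ X, ∃ z' ∈ X, dist e z = 1 ∧ dist z z' = 1 ∧ dist z' y = 1 with hW3
  set U := X.filter fun y => (X.filter fun q => dist y q = 1).card ≠ 12 ∧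
    ∃ e ∈ X, (Q e ∧ e - A u ∈ X ∧ (∀ w ∈ fccSlots, e - A u + A w ∈ X) ∧ ∃ v ∈ fccSlots, e + A v ∉ X) ∧
      W3 e y with hU
  -- every non-capped exit has an unsaturated ball within three
  have key : ∀ e ∈ EX.filter (fun e => ¬ capped e), ∃ y ∈ U, W3 e y := by
    intro e he
    rw [mem_filter] at he
    obtain ⟨heEX, hnc⟩ := he
    have heEX' := heEX
    rw [hEX, mem_filter] at heEX'
    obtain ⟨heX, hQ, hdX, hfull, v, hv, hvX⟩ := heEX'
    have hde : e - A u + A u = e := sub_add_cancel e (A u)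
    rcases exit_trichotomy hg hc hX A hdX hfull hu ⟨v, hv, by rw [hde]; exact hvX⟩ with
      ⟨y, hy, hw, hne⟩ | hcap
    · rw [hde] at hw
      refine ⟨y, ?_, hw⟩
      rw [hU, mem_filter]
      exact ⟨hy, hne, e, heX, ⟨hQ, hdX, hfull, v, hv, hvX⟩, hw⟩
    · exact absurd (by simpa only [hcapped, hde] using hcap) hnc
  choose! f hf using key
  -- fibres of `f` have at most 1885 elements
  have hfib : ∀ y ∈ (EX.filter fun e => ¬ capped e).image f,
      ((EX.filter fun e => ¬ capped e).filter fun e => f e = y).card ≤ 1885 := by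
    intro y _
    refine le_trans (card_le_card ?_) (card_withinThree_le hX y)
    intro e he
    rw [mem_filter] at he
    obtain ⟨he, hfe⟩ := he
    have hw := (hf e he).2
    rw [hfe] at hw
    rw [mem_filter]
    exact ⟨(mem_filter.1 (mem_filter.1 he).1).1, hw⟩
  have himg : (EX.filter fun e => ¬ capped e).image f ⊆ U := by
    intro y hy
    obtain ⟨e, he, rfl⟩ := mem_image.1 hy
    exact (hf e he).1
  have h1 : (EX.filter fun e => ¬ capped e).card ≤ 1885 * U.card :=
    calc (EX.filter fun e => ¬ capped e).card
        ≤ 1885 * ((EX.filter fun e => ¬ capped e).image f).card := card_le_mul_card_image _ _ hfib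
      _ ≤ 1885 * U.card := Nat.mul_le_mul_left _ (card_le_card himg)
  have h2 : EX.card = (EX.filter capped).card + (EX.filter fun e => ¬ capped e).card :=
    (card_filter_add_card_filter_not (s := EX) capped).symm
  show EX.card ≤ (EX.filter capped).card + 1885 * U.card
  omega

/-- **Payers near restricted exits are located near them.**  If every `Q`-exit has height `< c`, then every
payer (ball within contact distance three of a `Q`-exit) has height `< c + 3`. -/
theorem payer_height_lt (A : EuclideanSpace ℝ (Fin 3) ≃ₗᵢ[ℝ] EuclideanSpace ℝ (Fin 3))
    {u : EuclideanSpace ℝ (Fin 3)} (Q : EuclideanSpace ℝ (Fin 3) → Prop) (c : ℝ)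
    (hQ : ∀ e ∈ X, Q e → e - A u ∈ X → (∀ w ∈ fccSlots, e - A u + A w ∈ X) → e 2 < c)
    {y : EuclideanSpace ℝ (Fin 3)}
    (hy : ∃ e ∈ X, (Q e ∧ e - A u ∈ X ∧ (∀ w ∈ fccSlots, e - A u + A w ∈ X) ∧ ∃ v ∈ fccSlots, e + A v ∉ X) ∧
      (y = e ∨ dist e y = 1 ∨ (∃ z ∈ X, dist e z = 1 ∧ dist z y = 1) ∨
        ∃ z ∈ X, ∃ z' ∈ X, dist e z = 1 ∧ dist z z' = 1 ∧ dist z' y = 1)) :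
    y 2 < c + 3 := by
  obtain ⟨e, heX, ⟨hQe, hdX, hfull, -⟩, hw⟩ := hy
  have he := hQ e heX hQe hdX hfull
  -- one contact step changes the height by at most `1`
  have step : ∀ a b : EuclideanSpace ℝ (Fin 3), dist a b = 1 → b 2 ≤ a 2 + 1 := by
    intro a b hab
    have h3 := dist_sq_eq_three a b
    rw [hab] at h3
    nlinarith [sq_nonneg (a 0 - b 0), sq_nonneg (a 1 - b 1), sq_nonneg (a 2 - b 2 + 1)]
  rcases hw with rfl | h | ⟨z, -, hez, hzy⟩ | ⟨z, -, z', -, hez, hzz', hz'y⟩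
  · linarith
  · linarith [step e y h]
  · linarith [step e z hez, step z y hzy]
  · linarith [step e z hez, step z z' hzz', step z' y hz'y]

end Summit.Ventures.Crystal3D.Theorems

end
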